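import Mathlib
import HarnessLib
import HarnessLib.Audit
import Summits.CriticalPhenomena.Statement
import Literature.Probability.Percolation.CriticalContinuityProofs

/-!
Route: PercTwoPointDecay

It suffices to show X_A [polynomial decay of the ball-averaged critical two-point function]:
there are a > 0 and C such that for every R ≥ 1,  Σ_{x ∈ B(R)} τ_{p_c}(0,x) ≤ C · R^{3−a},
where τ_p(0,x) = P_p(0 ↔ x) is the connectivity of n.n. bond percolation on ℤ³ and B(R) = [−R,R]³.
Assembly (Grimmett1999 §8.5, p.213: τ_p(0,x) ≥ θ(p)² for all p, x by FKG + a.s. uniqueness): if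
θ(p_c) > 0 then
Σ_{x∈B(R)} τ_{p_c}(0,x) ≥ (2R+1)³ θ(p_c)², incompatible with C R^{3−a}. So (τ ≥ θ²) → X_A →
PercolationContinuityZ3.
The working crux is the SUBCRITICAL uniform form (r2): the same bound for all p < p_c with constants
independent of p;
it passes to p_c by continuity of p ↦ τ_p(0,x) (Grimmett1999 p.216–217; AizenmanKestenNewmanCMP1987)
and p_c > 0.

Lean (X_A): ∃ a C : ℝ, 0 < a ∧ ∀ R : ℕ, 1 ≤ R → ∑ x ∈ Literature.Probability.LatticeModels.box 3 R,
(Literature.Probability.Percolation.bondPercolation (Literature.Probability.LatticeModels.zdGraph 3)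
(Literature.Probability.Percolation.criticalProbI 3)).real
(Literature.Probability.Percolation.openConn 0 x) ≤ C * (R : ℝ) ^ (3 - a)

Rationale: WHY THIS LINE. In every dimension where θ(p_c) = 0 is a theorem for d ≥ 3 (d ≥ 11,
FitznerVanDerHofstad2017; HaraSlade1990)
the proof goes through an infrared / two-point-function bound at or uniformly below p_c, and for the
Ising model in d = 3 the
continuity of the magnetisation (AizenmanDuminilCopinSidoraviciusCMP2015) is likewise driven by the
Gaussian infrared bound
(reflection positivity). Percolation is not reflection positive, but DuminilCopinPanis2024
(arXiv:2410.03647) obtained the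
infrared bound for spread-out percolation in d > 6 WITHOUT lace expansion or RP, by a random-walk
comparison / reversed
Simon–Lieb scheme — a technology whose natural output is exactly an averaged bound Σ_{x∈B(R)}
τ_p(0,x) ≤ C R^{2+…} uniform in
p < p_c. This route asks for the weakest such output that still kills θ(p_c) > 0: ANY power saving a
> 0 over the trivial
bound |B(R)| = (2R+1)³. Area imported: Fourier/random-walk comparison and Simon–Lieb-type
subcritical two-point technology
(DuminilCopinPanis2024; Aizenman–Newman 1984 tree-graph bounds as in Grimmett1999 §6.3, §10.2;
Hutchcroft2020 for exponent inequalities).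
Numerics: τ_{p_c}(0,x) ≈ |x|^{-(1+η)} with η ≈ −0.05 in d = 3, so X_A is expected with a ≈ 0.95.

RANKED CRUXES.
 r2 SubcritBallAverageDecay (rank 2, hardest/most informative): ∃ a>0, C: ∀ p < p_c, ∀ R ≥ 1,
Σ_{x∈B(R)} τ_p(0,x) ≤ C R^{3−a}.
    Uniformity in p ↑ p_c is the whole content (for fixed p < p_c the sum is bounded by χ(p) < ∞).
 r3 CritPointwiseDecay (rank 3): ∃ a>0, C: τ_{p_c}(0,x) ≤ C ‖x‖^{−a} for x ≠ 0 (pointwise form;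
implies X_A; the x-space
    'infrared bound' would be a = 1).
 target CritBallAverageDecay (rank 0) = X_A;  Assembly (rank 1): TauLowerThetaSq → X_A →
PercolationContinuityZ3.
 support (rank 9): TauLowerThetaSq (τ ≥ θ², Grimmett1999 §8.5 p.213), TauContinuous (Grimmett1999
p.216–217),
    SubcritToCrit (p_c > 0 + TauContinuous + r2 ⇒ X_A: finite sums of continuous functions, left
limit at p_c).

KILL CRITERIA. The Gaussian infrared bound proper (a = 1 pointwise, i.e. τ_{p_c}(0,x) ≤ C/‖x‖, or
Σ_{B(R)} τ ≤ C R²) is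
numerically FALSE in d = 3 (η < 0): refuters should attack any proof attempt that would yield a ≥ 1,
and provers must not aim
at Gaussian domination itself. X_A, r2, r3 are strictly stronger than the conjunct (θ(p_c) = 0 gives
τ_{p_c} → 0 but no
rate): a refutation ¬X_A (critical two-point function decaying slower than every power on average)
closes the route without
touching the conjunct. Methodological kill: if the DuminilCopinPanis2024 comparison provably cannot
go below d = 6 even in
averaged/weakened form, close the route.

NOT DECOMPOSED: the k-space form of the bound; which random-walk comparison (n.n. vs spread-out
auxiliary model); the
Simon–Lieb / OSSS input; site vs bond.

Novelty: NOVELTY (retriage 2026-08-14). Nearest prior art and delta, verdict first: (1) the route's reduction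
"decay of τ_{p_c} (pointwise, Cesàro or ball-sum) ⇒ θ(p_c)=0" is the q=1 case of the
Aizenman–Duminil-Copin–Sidoravicius long-range-order criterion
[AizenmanDuminilCopinSidoraviciusCMP2015 §1.3–1.4; DuminilCopin2019 §4.3] and is ALREADY FORMAL in
the tree (Literature.Barriers.CriticalPhenomena.theta_eq_zero_of_tau_le_rpow,
theta_eq_zero_of_ballSum_le, theta_sq_le_ballAverage, tau_criticalProbI_le_of_forall_lt,
percolationContinuity_iff_tendsto_tau — an EQUIVALENCE, so any two-point route carries the whole
conjunct); (2) the exact shape of the target X_A — a ball-averaged power saving at criticality — is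
a THEOREM for long-range percolation on Z^d, all d, 0<α<d [Hutchcroft2022 Thm 1.1 =
arXiv:2202.07634: |Λ_r|^{-1}Σ_{Λ_r}P_{β_c}(0↔x) ≼ r^{−d+α}], whose p.5 names the nearest-neighbour
full-space average "very much open" and equivalent to continuity, and p.3 calls n.n. 3≤d≤6 "a
notorious open problem"; (3) the intended engine — two-point/infrared bounds uniform in p<p_c
WITHOUT reflection positivity or the lace expansion — exists only above d_c=6: spread-out d>6
[DuminilCopinPanis2024 = arXiv:2410.03647 Thm 1.1; p.8 Prop 2.2 "the place where the assumption that
d>6 plays a fundamental role"], the partially reversed Simon–Lieb inequality [PanisSchapira2026 =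
arXiv:2605.30299: Thm 1.2 holds for all d≥2 but every application (Thms 1.4–1.11) assumes d>6 and
the two-sided IRB (∗); p.4  [refs: 10.1063/5.0088450, 2202.07634, 2410.03647, 2605.30299, 2310.07640, 2510.03951, 2404.07276, 2009.13337, 1707.00520, doi:10.1063/5.0088450, AizenmanDuminilCopinSidoraviciusCMP2015, DuminilCopin2019, Hutchcroft2022, DuminilCopinPanis2024, PanisSchapira2026, FitznerVanDerHofstad2017, HeydenreichVanDerHofstad2017, GrimmettPercolation1999, BottcherHerrmann2021, Adler1984, MadrasSlade1993]

Barriers (technique_class: two-point-decay infrared-bound simon-lieb rw-comparison): BARRIERS (catalogue Literature/Barriers/CriticalPhenomena/, every PercolationContinuityZ3 entry read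
against technique_class "two-point-decay infrared-bound simon-lieb rw-comparison"):
- Literature.Barriers.CriticalPhenomena.GaussianDominationRoute (GaussianDominationRoute_holds;
EtaNegativePredictionZ3): APPLIES — this route is named in its `blocks`. Output side evaded by
design: X_A/r2/r3 ask for ANY a>0, not the Gaussian a=1 (XSpaceInfraredBoundSubcrit 3, Σ_{Λ_R}τ≤CR²
of theta_eq_zero_of_ballSum_le), so EtaNegativePredictionZ3 (¬PercInfraredBound 3, η<0) does not
contradict them (viable window a ≤ 1+η ≈ 0.95). Input side NOT evaded: the only sources of a
p<p_c-uniform two-point upper bound are reflection positivity (integer q≥2 only) and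
lace/random-walk comparison above d_c=6; the bet is that the DuminilCopinPanis2024 comparison
degrades into a lossy averaged bound in d=3 — unsupported by any source (its Prop 2.2 needs d>6;
PanisSchapira2026 p.4 expects φ_{p_c}(S) unbounded for d≤6).
- Literature.Barriers.CriticalPhenomena.LaceExpansionHighDimension
(LaceExpansionHighDimension_holds, not_meanField_three, TwoPointBoundedRatio.six_le): formally NOT
triggered — an exponent a<1 outputs neither EtaZeroXSpace 3 nor RhoExHalf 3; it is the route's KILL
criterion: an attempt whose output is the two-sided |x|^{2−d} law (TwoPointBoundedRatio 3) together
with ρ_ex=1/2 is refuted in d=3; and the triangle condition, through which every existing uniform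
bound is obtained, is expected in

Novelty grade: variant — ROUTE REVIEW 2026-08-15 (refuter): KEEP OPEN, grade VARIANT (concurs w/ self-grade). (1) 7/7 decls rc0 on post-rename tree; defs read back faithful (setBer on edgeSet of hasse Z^3 = n.n. bond; box=[-R,R]^3; rpow, R>=1; sup norm, x!=0): no junk/vacuity. (2) Support+glue 0834/0837/0838/0839 closable N (refuter refuter-rreview1-CriticalPhenomena-PercTwoPoint-81b08c2a-0, 2026-08-15T18:15:59Z; prior: arXiv:2202.07634, AizenmanDuminilCopinSidoraviciusCMP2015, arXiv:2410.03647, arXiv:2605.30299, HeydenreichVanDerHofstad2017, GrimmettPercolation1999)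

History (route lifecycle, newest last):
- 2026-08-16T03:59:16Z · AUTO-CRUX (backfill): CritBallAverageDecay — hypotheses of the deciding theorem that nothing in the route derives are cruxes (operator:999:1085951)

sub-problem: PercolationContinuityZ3 · status: open · opened planner-plan-CriticalPhenomena-PercolationContinuityZ3-0 2026-08-13T19:15:32Z · rev 4 · ledger route-CriticalPhenomena-PercTwoPointDecay
GENERATED by the gate from the ledger (D-0016/17). Provers cite these decls: `theorem foo : Summit.CriticalPhenomena.PercolationContinuityZ3.Theses.PercTwoPointDecay.<Decl> := …` in Summits/CriticalPhenomena/PercolationContinuityZ3/Theorems/<Name>.lean.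
-/

namespace Summit.CriticalPhenomena.PercolationContinuityZ3.Theses.PercTwoPointDecay

open scoped BigOperators Topology Manifold Classical MeasureTheory ProbabilityTheory Matrix InnerProductSpace ComplexConjugate ContinuousMap
open Filter Set Function TopologicalSpace MeasureTheory

attribute [summit_statement] _root_.PercolationContinuityZ3

/-- item stmt-CriticalPhenomena-0833 · crux (kind.auto-crux: conjecture-grade) · rank 0 · open · by planner
why it might fail: Stronger than θ(p_c)=0 (a rate). False iff η(3)≤−1, i.e. Σ_{B(R)}τ_{p_c} ≥ R^{3−o(1)}: excluded numerically (2−η≈2.05), not rigorously (only Σ≥cR known). Gaussian a=1 (Σ≤CR²) is itself predicted FALSE on Z³ (η<0): only a≤1+η≈0.95 viable; n.n. full-space average flagged open ⇔ continuity.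
sources: HeydenreichVanDerHofstad2017 (1.2.13) p.17 (E_{p_c}|C(0)∩Λ_n| = Σ_{Λ_n}τ_{p_c} ~ n^{2−η}) and p.48, Literature.Barriers.CriticalPhenomena.GaussianDominationRoute : theta_eq_zero_of_ballSum_le (a=1 form ⇒ θ=0, d≥3), EtaNegativePredictionZ3 (¬PercInfraredBound 3: Adler1984, MadrasSlade1993 §1.6 p.31, BottcherHerrmann2021 (2.11) η=−0.046(8)), Hutchcroft2022 = arXiv:2202.07634 Thm 1.1 (same shape proved for long-range percolation, a=d−α) and p.5 (n.n. full-space average open ⇔ continuity), DuminilCopin2019 §3 p.16 (φ_{p_c}(Λ_n) ≥ 1 ⇒ Σ_{Λ_R}τ_{p_c} ≥ cR: the only rigorous lower growth), grounder/refuter notes on this item (g9-7, g28-3, reground gen1): NEW/open for n.n. Z³; nearest print differs by dimension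
[target] X_A: some power saving in the ball-summed critical two-point function of bond percolation
on Z^3: ∃ a>0, C with Σ_{x∈B(R)} τ_{p_c}(0,x) ≤ C R^{3−a} for all R ≥ 1 (B(R) = box 3 R = [−R,R]^3,
τ_p(0,x) = P_p(0↔x)). Numerically a ≈ 0.95 (η ≈ −0.05). Sources: FitznerVanDerHofstad2017 §1.1;
DuminilCopinPanis2024 (arXiv:2410.03647). -/
@[route_item "route-CriticalPhenomena-PercTwoPointDecay"]
def CritBallAverageDecay : Prop :=
  ∃ a C : ℝ, 0 < a ∧ ∀ R : ℕ, 1 ≤ R → ∑ x ∈ Literature.Probability.LatticeModels.box 3 R, (Literature.Probability.Percolation.bondPercolation (Literature.Probability.LatticeModels.zdGraph 3) (Literature.Probability.Percolation.criticalProbI 3)).real (Literature.Probability.Percolation.openConn 0 x) ≤ C * (R : ℝ) ^ (3 - a)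

/-- item stmt-CriticalPhenomena-0835 · crux · rank 2 · open · by planner
why it might fail: As stated r2 ⇔ target X_A (τ_p ↑ in p; left-continuity): it is the whole open problem, not a step. False iff Σ_{B(R)}τ_{p_c} ≥ R^{3−o(1)} (η≤−1; numerics η≈−0.05; rigorous only Σ≥cR). The imported DCP2024 bootstrap controls its error only for d>6 (Prop 2.2); φ_{p_c}(S) expected unbounded for d≤6.
sources: DuminilCopinPanis2024 = arXiv:2410.03647: Thm 1.1 (spread-out, d>6, β≤β_c) and p.8 Prop 2.2 ('It is the place where the assumption that d>6 plays a fundamental role'), PanisSchapira2026 = arXiv:2605.30299: Thm 1.2 (partially reversed Simon–Lieb, all d≥2) vs Thms 1.4/1.7/1.8 (need d>6 AND the two-sided IRB (∗)); p.4 'we expect φ_{p_c}(S) to take arbitrarily large values in dimensions 2≤d≤6', HeydenreichVanDerHofstad2017 Thm 5.1 p.55 (τ̂_p(k)≤A/(1−D̂(k)) uniformly in p<p_c only for d≥d_0>6), Thm 10.1 (d≥11), Open Problem 10.1 p.134, (1.2.13) p.17 (Σ_{Λ_n}τ_{p_c} ~ n^{2−η}), Literature.Barriers.CriticalPhenomena.GaussianDominationRoute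 (EtaNegativePredictionZ3 := ¬PercInfraredBound 3; Adler1984; BottcherHerrmann2021 eq.(2.11): η=−0.046(8) in 3D) — a=1 predicted false, so only a<1 viable, Literature.StatMech.real_mono_of_isUpperSet (SharpnessDCTProofs.lean:286: τ_p≤τ_{p_c} for p<p_c, so X_A ⇒ r2) + Literature.Barriers.CriticalPhenomena.tau_criticalProbI_le_of_forall_lt (GaussianDominationRoute.lean:477: r2 ⇒ X_A) — r2 ⇔ target, DuminilCopin2019 (arXiv:1707.00520) §3 p.16: φ_{p_c}(Λ_n)≥1 for every n ⇒ χ(p_c)=∞ (only rigorous lower growth of the ball sum: Σ_{Λ_R}τ_{p_c} ≥ cR); DuminilCopinTassionCMP2016 Thm 1.1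
[crux] r2 (hardest, most informative): a power saving in the ball-summed two-point function
UNIFORMLY in the subcritical regime: ∃ a>0, C: ∀ p with p < p_c(Z^3), ∀ R ≥ 1, Σ_{x∈B(R)} P_p(0↔x) ≤
C R^{3−a}. For fixed p < p_c the left side is ≤ χ(p) < ∞ (sharpness), so the content is uniformity
as p ↑ p_c — an averaged, weakened infrared bound. Intended tools: random-walk comparison / reversed
Simon–Lieb of DuminilCopinPanis2024 (arXiv:2410.03647, spread-out d>6), tree-graph inequalities
(Grimmett1999 §6.3, §10.2). The Gaussian value a = 1 is numerically false in d = 3 (η<0): aim for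
small a>0. -/
@[route_item "route-CriticalPhenomena-PercTwoPointDecay"]
def SubcritBallAverageDecay : Prop :=
  ∃ a C : ℝ, 0 < a ∧ ∀ p : unitInterval, (p : ℝ) < Literature.Probability.Percolation.criticalProb (Literature.Probability.LatticeModels.zdGraph 3) 0 → ∀ R : ℕ, 1 ≤ R → ∑ x ∈ Literature.Probability.LatticeModels.box 3 R, (Literature.Probability.Percolation.bondPercolation (Literature.Probability.LatticeModels.zdGraph 3) p).real (Literature.Probability.Percolation.openConn 0 x) ≤ C * (R : ℝ) ^ (3 - a)

/-- item stmt-CriticalPhenomena-0836 · crux · rank 3 · open · by planner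
why it might fail: Pointwise decay at p_c on Z³ = Grimmett's open question/conj (9.12); proved only d≥11 (lace) and long-range or spread-out d>6 models. No upper-bound method below d_c: ANY τ_{p_c}→0 is ⇔ θ(p_c)=0. False iff τ_{p_c}(0,x_k) ≥ ‖x_k‖^{−o(1)} on a sequence; rigorous lower bound only c‖x‖^{−2d(d−1)}.
sources: GrimmettPercolation1999 §8.5 p.213 (open question at p=p_c) and (9.12) p.235 (conjecture τ_{p_c}(0,x) ≈ |x|^{2−d−η}), Hara2008 Thm 1.1 (d≥19) / FitznerVanDerHofstad2017 (d≥11): τ_{p_c}(x) = A|x|^{2−d}(1+o(1)); HeydenreichVanDerHofstad2017 Thm 11.4 p.137, Hutchcroft2022 = arXiv:2202.07634 (doi:10.1063/5.0088450) Thm 1.1: |Λ_r|^{-1}Σ_{Λ_r}P_{β_c}(0↔x) ≼ r^{−d+α} for LONG-RANGE percolation, all d, 0<α<d; p.3 'nearest-neighbour … 3≤d≤6 is a notorious open problem'; p.5 full-space n.n. estimate 'remains very much open' ⇔ continuity, Literature.Barriers.CriticalPhenomena.theta_eq_zero_of_tau_le_rpow + percolationContinuity_iff_tendsto_tau (GaussianDominationRoute.lean:320/313):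 r3 ⇒ θ(p_c)=0, and any decay τ_{p_c}→0 ⇔ conjunct, DuminilCopin2019 (arXiv:1707.00520) §3 Exercise 5 p.17: P_{p_c}[0↔x] ≥ c/‖x‖^{2d(d−1)} (rigorous pointwise LOWER bound, all d), Literature.Barriers.CriticalPhenomena.LaceExpansionHighDimension (not_meanField_three, TwoPointBoundedRatio.six_le): an attempt outputting two-sided |x|^{2−d} (a=1) with ρ=1/2 is impossible in d=3 — kill criterion for over-strong proofs
[crux] r3: pointwise polynomial decay of the critical two-point function on Z^3: ∃ a>0, C:
P_{p_c}(0↔x) ≤ C‖x‖^{−a} for x ≠ 0 (‖·‖ = sup norm on Fin 3 → ℤ). Implies X_A by summation.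
Grimmett1999 §8.5 p.213: "It is an open question to determine the behaviour of τ_p(x,y) when p =
p_c". Known in d ≥ 11 with a = d−2 (Hara; FitznerVanDerHofstad2017). Attachment point for any
two-point upper bound at criticality. -/
@[route_item "route-CriticalPhenomena-PercTwoPointDecay"]
def CritPointwiseDecay : Prop :=
  ∃ a C : ℝ, 0 < a ∧ ∀ x : Literature.Probability.LatticeModels.Site 3, x ≠ 0 → (Literature.Probability.Percolation.bondPercolation (Literature.Probability.LatticeModels.zdGraph 3) (Literature.Probability.Percolation.criticalProbI 3)).real (Literature.Probability.Percolation.openConn 0 x) ≤ C * ‖x‖ ^ (-a)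

/-- item stmt-CriticalPhenomena-5786 · crux · rank 4 · open · by planner
why it might fail: No upper bound on critical in-box connectivity is known on Z^3 (lace/IRB only d>=11); even the qualitative o(R^3) is unlocated folklore (arXiv:2202.07634 p.5); lowest-point BK+BGN needs x_s+x_b>3/2 vs numerics 1.45; 5786's own strategist census (2026-08-17): no-strategy-short-of-summit.
sources: Hutchcroft2022, arXiv:2202.07634, Hutchcroft2021, arXiv:2008.11197, HeydenreichVanDerHofstad2017, FitznerVanDerHofstad2017
[crux] S(1/2), card item 'Crux S' at a = 1/2, CENTRE-rooted (weaker than the card's sup over roots;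
the race needs only the centre): there is C with Σ_{y ∈ box 3 R} P_{p_c}(0 ↔ y inside box 3 R) ≤ C ·
R^{5/2} for every R ≥ 1, i.e. the expected volume of the free-boundary (in-box) cluster of the
centre of Λ_R is O(R^{5/2}). Truth: ≍ R^{2−η} = R^{2.05} (η = −0.046); the Gaussian value R² is
predicted FALSE (EtaNegativePredictionZ3), R^{5/2} leaves margin 0.45. It is strictly weaker than
PercTwoPointDecay.CritBallAverageDecay restricted to a = 1/2 (bulk sum Σ_{box 3 R} τ_{p_c}(0,y) ≤ C
R^{5/2} implies it, openConnIn ⊆ openConn) and, unlike the bulk sum, is compatible with θ(p_c) > 0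
(a shattered jump world); but any a > 0 excludes the MONOLITHIC jump branch (linear-scale in-box LRO
at p_c would give Σ ≥ c R³), so it is an honest crux, not folklore (cards
free-box-shattering-is-a-branch, free-box-folklore-knife-edge). Shape = Hutchcroft2022 eq. (weaker)
for nearest-neighbour ℤ³ with d − α := 1/2. [difficulty: open-problem] -/
@[route_item "route-CriticalPhenomena-PercTwoPointDecay"]
def FreeSusceptibilityPowerSaving : Prop :=
  ∃ C : ℝ, ∀ R : ℕ, 1 ≤ R → ∑ y ∈ Literature.Probability.LatticeModels.box 3 R, (Literature.Probability.Percolation.bondPercolation (Literature.Probability.LatticeModels.zdGraph 3) (Literature.Probability.Percolation.criticalProbI 3)).real (Literature.Probability.Percolation.openConnIn ↑(Literature.Probability.LatticeModels.box 3 R) 0 y) ≤ C * (R : ℝ) ^ ((5 : ℝ) / 2)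

/-- item stmt-CriticalPhenomena-4643 · crux · rank 5 · open · by planner
why it might fail: Open '<=' half of hyperscaling (2/rho >= d-2+eta; BK/BCKS give only '>='), unproved for 3<=d<=6 even granting exponents (Hutchcroft2021 p.10); FALSE for d>=11 (pi_n~n^-2, tau~|x|^(2-d): pi_n^2/avg tau ~ n^(d-6) -> oo); box factor K unproved.
sources: Hutchcroft2021, arXiv:2008.11197, BorgsChayesKestenSpencer1999, Aizenman1997, GrimmettPercolation1999, KozmaNachmias2011
[crux] BoxGluing(K) (card r2): ∃ C > 0, K ≥ 1 such that ∀ n ≥ 1, P_{p_c}(0 ↔ ∂Λ_n)² ≤ C · |Λ_n|⁻¹ ·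
Σ_{x ∈ Λ_n} P_{p_c}(0 ↔ x inside Λ_{Kn}) for bond percolation on ℤ³ at p_c = criticalProbI 3 (Λ_m =
box 3 m; "inside" = openConnIn ↑(box 3 (K n))). Exponent reading: 2β/ν ≤ d−2+η (the open half; "≥"
is BK). In a jump world it says θ*² ≤ C·(averaged linear-scale in-box LRO), i.e. jump ⟹ monolithic.
[difficulty: open-problem] -/
@[route_item "route-CriticalPhenomena-PercTwoPointDecay"]
def BoxGluing : Prop :=
  ∃ C : ℝ, ∃ K : ℕ, 0 < C ∧ 1 ≤ K ∧ ∀ n : ℕ, 1 ≤ n → (Literature.Probability.Percolation.bondPercolation (Literature.Probability.LatticeModels.zdGraph 3) (Literature.Probability.Percolation.criticalProbI 3)).real (Literature.Probability.Percolation.siteToBoundary 3 n) ^ 2 ≤ C * ((Literature.Probability.LatticeModels.box 3 n).card : ℝ)⁻¹ * ∑ x ∈ Literature.Probability.LatticeModels.box 3 n, (Literature.Probability.Percolation.bondPercolation (Literature.Probability.LatticeModels.zdGraph 3) (Literature.Probability.Percolation.criticalProbI 3)).real (Literature.Probability.Percolation.openConnIn ↑(Literature.Probability.LatticeModels.box 3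 (K * n)) 0 x)

/-- item stmt-CriticalPhenomena-0837 · support · rank 9 · closed · proved by Summit.CriticalPhenomena.PercolationContinuityZ3.Theorems.tauLowerThetaSq_proof @ f648441f8c8f (prover) · by planner
[support] τ_p(0,x) ≥ θ(p)² for every p ∈ [0,1] and x ∈ Z^3: P_p(0↔x) ≥ P_p(|C(0)|=∞, |C(x)|=∞) ≥
θ(p)² by a.s. uniqueness of the infinite cluster (AizenmanKestenNewmanCMP1987 / Burton–Keane,
Grimmett1999 Thm (8.1)) and Harris–FKG (Literature.Probability.Percolation.harris_fkg, Grimmett1999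
Thm (2.4)); Grimmett1999 §8.5, display on p.213. Expected to close by citation + two lines; a Z^d
uniqueness fact is wanted in Literature (only the Z^2 form unique_infinite_cluster exists). -/
@[route_item "route-CriticalPhenomena-PercTwoPointDecay"]
def TauLowerThetaSq : Prop :=
  ∀ (p : unitInterval) (x : Literature.Probability.LatticeModels.Site 3), Literature.Probability.Percolation.theta (Literature.Probability.LatticeModels.zdGraph 3) 0 p ^ 2 ≤ (Literature.Probability.Percolation.bondPercolation (Literature.Probability.LatticeModels.zdGraph 3) p).real (Literature.Probability.Percolation.openConn 0 x)

/-- item stmt-CriticalPhenomena-0838 · support · rank 9 · closed · proved by Summit.CriticalPhenomena.PercolationContinuityZ3.Theorems.PercTwoPointDecayTauContinuous.tauContinuous_proof @ 49bd5c97aa20 (prover) · by planner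
[support] For each x, p ↦ τ_p(0,x) = P_p(0↔x) is continuous on [0,1] (bond percolation on Z^3).
Grimmett1999 §8.3 pp.216–217 (lower semicontinuity from local approximations, upper semicontinuity
via uniqueness); AizenmanKestenNewmanCMP1987. Used to pass r2 (p < p_c) to p = p_c. -/
@[route_item "route-CriticalPhenomena-PercTwoPointDecay"]
def TauContinuous : Prop :=
  ∀ x : Literature.Probability.LatticeModels.Site 3, Continuous fun p : unitInterval => (Literature.Probability.Percolation.bondPercolation (Literature.Probability.LatticeModels.zdGraph 3) p).real (Literature.Probability.Percolation.openConn 0 x)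

/-- item stmt-CriticalPhenomena-0839 · support · rank 9 · closed · proved by Summit.CriticalPhenomena.PercolationContinuityZ3.Theorems.PercTwoPointDecaySubcritToCrit.subcritToCrit_proof @ 756783df52e2 (prover) · by planner
[support] glue: (0 < p_c(Z^d) < 1 for d ≥ 2,
Literature.Probability.Percolation.Grimmett1999_criticalProb_pos_lt_one) → TauContinuous → r2 → X_A.
Proof: for R fixed the finite sum Σ_{x∈B(R)} τ_p(0,x) is continuous in p; since p_c > 0 there are p
< p_c arbitrarily close (unitInterval has the order topology), and the bound C R^{3−a} holds for all
of them, hence at p_c. -/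
@[route_item "route-CriticalPhenomena-PercTwoPointDecay"]
def SubcritToCrit : Prop :=
  Literature.Probability.Percolation.Grimmett1999_criticalProb_pos_lt_one → (∀ x : Literature.Probability.LatticeModels.Site 3, Continuous fun p : unitInterval => (Literature.Probability.Percolation.bondPercolation (Literature.Probability.LatticeModels.zdGraph 3) p).real (Literature.Probability.Percolation.openConn 0 x)) → (∃ a C : ℝ, 0 < a ∧ ∀ p : unitInterval, (p : ℝ) < Literature.Probability.Percolation.criticalProb (Literature.Probability.LatticeModels.zdGraph 3) 0 → ∀ R : ℕ, 1 ≤ R → ∑ x ∈ Literature.Probability.LatticeModels.box 3 R, (Literature.Probability.Percolation.bondPercolation (Literature.Probability.LatticeModels.zdGraph 3) p).real (Literature.Probability.Percolation.openConn 0 x) ≤ C * (R : ℝ) ^ (3 - a)) → (∃ a C : ℝ, 0 < a ∧ ∀ R : ℕ, 1 ≤ R → ∑ x ∈ Literature.Probability.LatticeModels.box 3 R, (Literature.Probability.Percolation.bondPercolation (Literature.Probability.LatticeModels.zdGraph 3) (Literature.Probability.Percolation.criticalProbI 3)).real (Literature.Probability.Percolation.openConn 0 x) ≤ C * (R : ℝ)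 ^ (3 - a))

/-- item stmt-CriticalPhenomena-14315 · support · rank 9 · closed · proved by Summit.CriticalPhenomena.PercolationContinuityZ3.Theorems.PercTwoPointDecayTargetOfSubcrit.targetOfSubcrit_proof @ 756783df52e2 (prover) · by planner
sources: GrimmettPercolation1999 §8.3 p.203, arXiv:1707.00520 §4.3 p.29, Literature.Barriers.CriticalPhenomena.ballSum_tau_criticalProbI_le_of_forall_lt (GaussianDominationRoute.lean:669)
[support] glue r2 → target (gate shape route.target-unreachable; route-choice repair 2026-08-16,
option (a)): the p < p_c–uniform ball-sum bound ∃ a>0, C: ∀ p<p_c, ∀ R ≥ 1, Σ_{x∈Λ_R} τ_p(0,x) ≤ C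
R^{3−a} holds verbatim at p = p_c(ℤ³) with the SAME a, C. Proof (PROVABLE NOW; planner Sketch.lean
`theorem targetOfSubcrit_holds : TargetOfSubcrit`, lean rc 0, axioms standard):
`Literature.Barriers.CriticalPhenomena.ballSum_tau_criticalProbI_le_of_forall_lt (d := 3) (by
norm_num) R (c := C * R ^ (3 - a))` (left-continuity transfer for ball sums: each finite-box
probability P_p(0 ↔ x in Λ_n) is continuous in p, τ_{p_c}(0,x) is their monotone limit, and p_c(ℤ³)
> 0 — criticalProb_zd_pos) plus `Literature.Probability.Percolation.tau_def` (τ = (bondPercolation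
(zdGraph 3) p).real (openConn 0 x), rfl). No uniqueness / full continuity of τ_p needed (contrast
the older support SubcritToCrit). Sources: GrimmettPercolation1999 §8.3 p.203; DuminilCopin2019
(arXiv:1707.00520) §4.3 p.29 ('by letting β ↗ β_c'). [deps: SubcritBallAverageDecay,
CritBallAverageDecay] [difficulty: provable-now] -/
@[route_item "route-CriticalPhenomena-PercTwoPointDecay"]
def TargetOfSubcrit : Prop :=
  SubcritBallAverageDecay → CritBallAverageDecay

/-- item stmt-CriticalPhenomena-14316 · support · rank 9 · closed · proved by Summit.CriticalPhenomena.PercolationContinuityZ3.Theorems.PercTwoPointDecayTargetOfPointwise.targetOfPointwise_proof @ e8f39eb9a073 (prover) · by planner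
sources: HeydenreichVanDerHofstad2017 (1.2.13) p.17, Literature.Probability.LatticeModels.sum_box_erase_norm_rpow_le (CriticalEtaUpperDCPProofs.lean)
[support] glue r3 → target (gate shape route.target-unreachable; route-choice repair 2026-08-16,
option (a)): pointwise decay τ_{p_c}(0,x) ≤ C‖x‖^{−a} (x ≠ 0, sup norm on ℤ³) sums over Λ_R = box 3
R to Σ_{x∈Λ_R} τ_{p_c}(0,x) ≤ (1 + 54·max C 0) · R^{3−a'} with a' = min a 2 > 0. Proof (PROVABLE
NOW; planner Sketch.lean `theorem targetOfPointwise_holds : TargetOfPointwise`, lean rc 0, axioms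
standard): off the origin ‖x‖ ≥ 1 (Site.norm_eq_supNorm, Site.supNorm_eq_zero_iff) so ‖x‖^{−a} ≤
‖x‖^{−a'}; shell count `Literature.Probability.LatticeModels.sum_box_erase_norm_rpow_le a' R` :
Σ_{Λ_R∖0} ‖x‖^{−a'} ≤ 54 Σ_{m<R} (m+1)^{2−a'} ≤ 54 R·R^{2−a'} = 54 R^{3−a'} (2 − a' ≥ 0); origin
term τ(0,0) = 1 ≤ R^{3−a'} (tau_self, Real.one_le_rpow); split with Finset.add_sum_erase
(zero_mem_box 3 R). Sources: HeydenreichVanDerHofstad2017 (1.2.13) p.17 (ball sum ~ n^{2−η} from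
pointwise |x|^{2−d−η}); folklore shell count |∂Λ_m| ≤ 54 m² in d = 3. [deps: CritPointwiseDecay,
CritBallAverageDecay] [difficulty: provable-now] -/
@[route_item "route-CriticalPhenomena-PercTwoPointDecay"]
def TargetOfPointwise : Prop :=
  CritPointwiseDecay → CritBallAverageDecay

/-- item stmt-CriticalPhenomena-17863 · support · rank 9 · closed · proved by Summit.CriticalPhenomena.PercolationContinuityZ3.Theorems.PercTwoPointDecayCritBallAverageDecayOfSubs.critBallAverageDecayOfSubs_proof @ 756783df52e2 (prover) · by planner
sources: GrimmettPercolation1999, KozmaNachmias2011, Hutchcroft2021, arXiv:2202.07634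
[support] SPLIT GLUE (crux-strategist BC2-redirect of the restated deciding crux, 2026-08-17):
FreeSusceptibilityPowerSaving → BoxGluing → CritBallAverageDecay. Proof (PROVED, kernel-checked rc
0, sorry-free, axioms propext/Classical.choice/Quot.sound; file attached as evidence on
stmt-CriticalPhenomena-0833 and published as
Cruxes/CritBallAverageDecay/PercTwoPointDecayCritBallAverageDecaySplit.lean, theorem
CritBallAverageDecaySplit.critBallAverageDecay_of_subs — a prover lands it verbatim under Theorems/,
planner seats cannot): from BoxGluing, π_n² ≤ C·|Λ_n|⁻¹·Σ_{x∈Λ_n} P(0↔x in Λ_{Kn}) ≤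
C·|Λ_n|⁻¹·Σ_{x∈Λ_{Kn}} P(0↔x in Λ_{Kn}) (box_mono, terms ≥ 0) ≤ C·(2n+1)⁻³·C'·(Kn)^{5/2}
(FreeSusceptibilityPowerSaving at R = Kn) ≤ C|C'|K^{5/2}·n^{-1/2}; hence the one-arm rate π_{p_c}(n)
= oneArmProb 3 (criticalProbI 3) n ≤ D·n^{-1/4}, D = (C|C'|K^{5/2})^{1/2}; the landed shell
summation FreeBoxPowerSavingNegative.sum_tau_box_le_of_oneArm_rpow (τ(0,z) ≤ π(⌊(‖z‖−1)/2⌋)² by BK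
over two disjoint boxes, |∂Λ_k| ≤ 54k²) at s = 1/4 gives Σ_{z∈Λ_R} τ_{p_c}(0,z) ≤ (125 + 864
D²)·R^{3−1/2} for R ≥ 1, i.e. CritBallAverageDecay with a = 1/2 (tau_def). [difficulty: provable-now
— port the attached file] [ -/
@[route_item "route-CriticalPhenomena-PercTwoPointDecay"]
def CritBallAverageDecayOfSubs : Prop :=
  FreeSusceptibilityPowerSaving → BoxGluing → CritBallAverageDecay

/-- item stmt-CriticalPhenomena-0834 · assembly · rank 1 · closed · proved by Summit.CriticalPhenomena.PercolationContinuityZ3.Theorems.PercTwoPointDecayAssembly.assembly_proof @ 175ae9e337de (prover) · by planner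
[assembly] (τ_p(0,x) ≥ θ(p)² for all p, x — Grimmett1999 §8.5 p.213) → X_A →
PercolationContinuityZ3. Proof: if θ(p_c) ≠ 0 then θ(p_c) > 0 (measureReal_nonneg); summing τ ≥ θ²
over box 3 R (card = (2R+1)^3, Literature.Probability.LatticeModels.card_box) gives (2R+1)^3 θ² ≤ C
R^{3−a}, i.e. θ² ≤ C R^{−a} → 0 (Real.rpow with a > 0), contradiction. -/
@[route_item "route-CriticalPhenomena-PercTwoPointDecay"]
def Assembly : Prop :=
  (∀ (p : unitInterval) (x : Literature.Probability.LatticeModels.Site 3), Literature.Probability.Percolation.theta (Literature.Probability.LatticeModels.zdGraph 3) 0 p ^ 2 ≤ (Literature.Probability.Percolation.bondPercolation (Literature.Probability.LatticeModels.zdGraph 3) p).real (Literature.Probability.Percolation.openConn 0 x)) → (∃ a C : ℝ, 0 < a ∧ ∀ R : ℕ, 1 ≤ R → ∑ x ∈ Literature.Probability.LatticeModels.box 3 R, (Literature.Probability.Percolation.bondPercolation (Literature.Probability.LatticeModels.zdGraph 3) (Literature.Probability.Percolation.criticalProbI 3)).real (Literature.Probability.Percolation.openConn 0 x) ≤ C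 * (R : ℝ) ^ (3 - a)) → PercolationContinuityZ3

/-! D-0027 §2.1 — DECIDING THEOREM (planner-authored via `route open/edit --closes-file`; by planner-rbadge-CriticalPhenomena-PercTwoPointD-81b08c2a-g4-0 2026-08-15T16:21:17Z):
its hypotheses are this route's items and its conclusion the sub-problem Statement (glue_lint), and it elaborates with this file. -/

@[closes "route-CriticalPhenomena-PercTwoPointDecay"] theorem closes (hT : TauLowerThetaSq) (hX : CritBallAverageDecay) : PercolationContinuityZ3 := by
  -- The statement unfolds to `θ_{ℤ³}(p_c) = 0`.
  show Literature.Probability.Percolation.theta (Literature.Probability.LatticeModels.zdGraph 3) 0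
      (Literature.Probability.Percolation.criticalProbI 3) = 0
  unfold TauLowerThetaSq at hT
  unfold CritBallAverageDecay at hX
  obtain ⟨a, C, ha, h⟩ := hX
  set pc : unitInterval := Literature.Probability.Percolation.criticalProbI 3 with hpc
  set t : ℝ := Literature.Probability.Percolation.theta (Literature.Probability.LatticeModels.zdGraph 3) 0 pc
    with ht
  -- Step 1 (Grimmett 1999 §8.5, p. 213): summing `θ(p_c)² ≤ τ_{p_c}(0,x)` over the box `Λ_R`,
  -- `|Λ_R| = (2R+1)³ ≥ R³`, and comparing with `Σ_{Λ_R} τ ≤ C R^{3-a}` gives `θ(p_c)² ≤ C R^{-a}`.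
  have key : ∀ R : ℕ, 1 ≤ R → t ^ 2 ≤ C * (R : ℝ) ^ (-a) := by
    intro R hR
    have hR' : (1 : ℝ) ≤ R := by exact_mod_cast hR
    have hRpos : (0 : ℝ) < R := by linarith
    have hcard : ((Literature.Probability.LatticeModels.box 3 R).card : ℝ) = (2 * (R : ℝ) + 1) ^ 3 := by
      rw [Literature.Probability.LatticeModels.card_box]; push_cast; ring
    have h1 : t ^ 2 * (Literature.Probability.LatticeModels.box 3 R).card ≤
        ∑ x ∈ Literature.Probability.LatticeModels.box 3 R,
          (Literature.Probability.Percolation.bondPercolation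
            (Literature.Probability.LatticeModels.zdGraph 3) pc).real
            (Literature.Probability.Percolation.openConn 0 x) := by
      calc t ^ 2 * (Literature.Probability.LatticeModels.box 3 R).card
          = ∑ _x ∈ Literature.Probability.LatticeModels.box 3 R, t ^ 2 := by
            rw [Finset.sum_const, nsmul_eq_mul, mul_comm]
        _ ≤ _ := Finset.sum_le_sum fun x _ => hT pc x
    have h2 : (R : ℝ) ^ 3 ≤ (Literature.Probability.LatticeModels.box 3 R).card := by
      rw [hcard]
      exact pow_le_pow_left₀ (by positivity) (by linarith) 3
    have h3 : t ^ 2 * (R : ℝ) ^ 3 ≤ C * (R : ℝ) ^ (3 - a) :=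
      (mul_le_mul_of_nonneg_left h2 (sq_nonneg t)).trans (h1.trans (h R hR))
    have hnat : (R : ℝ) ^ (3 : ℝ) = (R : ℝ) ^ (3 : ℕ) := by
      exact_mod_cast Real.rpow_natCast (R : ℝ) 3
    have hsplit : (R : ℝ) ^ (3 - a) = (R : ℝ) ^ (3 : ℕ) * (R : ℝ) ^ (-a) := by
      rw [sub_eq_add_neg, Real.rpow_add hRpos, hnat]
    have hR3 : (0 : ℝ) < (R : ℝ) ^ (3 : ℕ) := by positivity
    have h4 : t ^ 2 * (R : ℝ) ^ (3 : ℕ) ≤ C * (R : ℝ) ^ (-a) * (R : ℝ) ^ (3 : ℕ) := by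
      calc t ^ 2 * (R : ℝ) ^ (3 : ℕ) ≤ C * (R : ℝ) ^ (3 - a) := h3
        _ = C * (R : ℝ) ^ (-a) * (R : ℝ) ^ (3 : ℕ) := by rw [hsplit]; ring
    exact le_of_mul_le_mul_right h4 hR3
  -- Step 2: `C R^{-a} → 0` as `R → ∞` (`a > 0`), hence `θ(p_c)² ≤ 0`, i.e. `θ(p_c) = 0`.
  have hlim : Filter.Tendsto (fun R : ℕ => C * (R : ℝ) ^ (-a)) Filter.atTop (nhds 0) := by
    have h1 := ((tendsto_rpow_neg_atTop ha).comp tendsto_natCast_atTop_atTop).const_mul C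
    rw [mul_zero] at h1
    exact h1
  have h2 : t ^ 2 ≤ 0 :=
    ge_of_tendsto hlim (Filter.eventually_atTop.2 ⟨1, fun R hR => key R hR⟩)
  have ht0 : t ^ 2 = 0 := le_antisymm h2 (sq_nonneg t)
  exact pow_eq_zero_iff two_ne_zero |>.1 ht0

end Summit.CriticalPhenomena.PercolationContinuityZ3.Theses.PercTwoPointDecay
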